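import Summits.ResolutionOfSingularities.ResolutionOfSingularities.Theorems.FrobeniusLadderFRationalResolutionToricBaseRegular
import Summits.ResolutionOfSingularities.ResolutionOfSingularities.Theorems.FrobeniusLadderFRationalResolutionToricXChartRegular
import Summits.ResolutionOfSingularities.ResolutionOfSingularities.Theorems.FrobeniusLadderFRationalResolutionToricTorusLocalization
import Summits.ResolutionOfSingularities.ResolutionOfSingularities.Theorems.FrobeniusLadderFRationalResolutionToricTheta
import Summits.ResolutionOfSingularities.ResolutionOfSingularities.Theorems.FrobeniusLadderFRationalResolutionToricYChartCarrier
import Summits.ResolutionOfSingularities.ResolutionOfSingularities.Theorems.FrobeniusLadderFRationalResolutionToricIsoAwayW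
import Summits.ResolutionOfSingularities.ResolutionOfSingularities.Theorems.FrobeniusLadderFRationalResolutionToricChart
import HarnessLib

/-!
# Toric surface programme: the Hirzebruch–Jung step `P(a, ⌈r/a⌉a − r) ⇒ P(r, a)`, the base, and rung 4′ on all affine toric surfaces

Support file for crux stmt-ResolutionOfSingularities-15317 (`FrobeniusLadder.FRationalResolution`), line `redirect`,
lead c4. For every field `k` and `0 ≤ a < r` let `U(r,a) = Spec TA[r,a]`, `TA[r,a] = k[{m ∈ ℤ² : 0 ≤ m₂, a m₂ ≤ r m₁}]`
(the affine toric surface of the cone `σ = cone((0,1),(r,−a))`, i.e. every cyclic quotient surface singularity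
`1/r(1,a)`), with facet monomials `x = χ^(1,0)`, `w = χ^(a,r)` and interior monomial `xy = χ^(1,1)`. Let
`P(r,a)` say: `U(r,a)` receives a proper morphism from a regular scheme which is an isomorphism over
`D(x) ∪ D(w)` (the complement of the torus-fixed point) with dense preimage.

* (tools in `…ToricChart.lean`: `chart_openImmersion_of_range`, `isRegular_opens_of_isIso_morphismRestrict`);
* `toric_step` — **`P(a, a′) ⇒ P(r, a)`** for `1 ≤ a < r`, `a′ + r = d a`, `a′ < a`: blow up `I = (xy, x, x)`;
  `π₀` is proper, an iso over `D(x)` (generator) and over `D(w)` (`stub_toric_isIso_away_w`), with dense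
  preimage of `D(x)`; the charts `D₊(x t)` are affine planes (`stub_toric_xChart_isRegularRing`) and the chart
  `D₊(xy t)` IS `U(a, a′)` (`stub_toric_isLocalization_away` + `stub_toric_yChart_carrier` + `stub_toric_theta`:
  `f = e⁻¹ ∘ Θ : TA[a,a′] → TA[r,a][1/xy]` is injective onto `TA[r,a][I/xy]` with `f x′ · xy = x`, `f w′ = w`),
  so `towerStep` applies with `U_V = D(x′) ∪ D(w′)`;
* `toric_base` — `P(r, 0)` (`TA[r,0] = k[ℕ²]` is regular, `stub_toric_base_isRegularRing`);
* `stub_toric_offVertex_resolution` — `P(r, a)` for all `a < r` (strong induction on `r`: `(r,a) ↦ (a, ⌈r/a⌉a − r)`);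
* `hasResolution_toricSurface` — **RUNG 4′ ON ALL AFFINE TORIC SURFACES, EVERY FIELD**.

All folklore (Cox–Little–Schenck 2011 §10.1–10.2; Fulton 1993 §2.6; Kollár 2007 §2.2); no published fact is used.
-/

-- single-problem summit: the doubled namespace component is forced
set_option linter.dupNamespace false

noncomputable section

namespace Summit.ResolutionOfSingularities.ResolutionOfSingularities.Theorems.FRationalResolution

open CategoryTheory AlgebraicGeometry TopologicalSpace
open Literature.AlgebraicGeometry.Resolution

section Toric

variable (k : Type) [Field k]

/-- The Laurent polynomial ring `k[ℤ²]` (coordinate ring of the 2-torus). -/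
local notation3 "Lk" => AddMonoidAlgebra k (ℤ × ℤ)

/-- The lattice points of the dual cone `σ∨ = {m₂ ≥ 0, a m₂ ≤ r m₁}` of `σ = cone((0,1),(r,-a))`. -/
local notation3 "σS[" r ", " a "]" =>
  {m : ℤ × ℤ | 0 ≤ m.2 ∧ ((a : ℕ) : ℤ) * m.2 ≤ ((r : ℕ) : ℤ) * m.1}

/-- The toric surface algebra `k[σ∨ ∩ ℤ²] ⊆ k[ℤ²]`. -/
local notation3 "TA[" r ", " a "]" =>
  Algebra.adjoin k ((fun m : ℤ × ℤ => AddMonoidAlgebra.single m (1 : k)) '' σS[r, a])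

/-- A monomial `χᵐ` of `TA[r,a]` is a nonzero element. [folklore] -/
theorem toric_single_ne_zero (r a : ℕ) (z : ↥TA[r, a]) (m : ℤ × ℤ)
    (hz : (z : Lk) = AddMonoidAlgebra.single m 1) : z ≠ 0 := fun h0 => by
  have h1 := congrArg Subtype.val h0
  rw [hz, ZeroMemClass.coe_zero, AddMonoidAlgebra.single_eq_zero] at h1
  exact one_ne_zero h1

set_option maxHeartbeats 400000 in
/-- **THE HIRZEBRUCH–JUNG STEP `P(a, a′) ⇒ P(r, a)`** (`1 ≤ a < r`, `a′ + r = d a`, `a′ < a`). Blow up the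
centre `I = (xy, x, x)` of `U(r,a)`: `π₀ : B = Bl_I U(r,a) → U(r,a)` is proper, an isomorphism over `D(x)`
(a generator) and over `D(w)` (`stub_toric_isIso_away_w`), with dense preimage of `D(x)`;
`B = D₊(x t) ∪ D₊(x t) ∪ D₊(xy t)` with the first two charts affine planes (`stub_toric_xChart_isRegularRing`)
and the third equal to `U(a, a′)`: `f = e⁻¹ ∘ Θ : TA[a,a′] → TA[r,a][1/xy]` (`e : TA[r,a][1/xy] ≅ Lk`,
`stub_toric_isLocalization_away`; `Θ` the unimodular substitution, `stub_toric_theta`) is injective with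
range `TA[r,a][I/xy]` (`stub_toric_yChart_carrier`) and `f x′ · xy = x`, `f w′ = w`, so under the open
immersion `iV : U(a,a′) → B` one has `iV⁻¹ D₊(x t) = D(x′)` and `(iV ≫ π₀)⁻¹ D(w) = D(w′)`, whence
`π₀⁻¹ (D(x) ∪ D(w)) ⊆ D₊(x t) ∪ iV(D(x′) ∪ D(w′))`; the open `D(x′) ∪ D(w′)` of `U(a,a′)` is regular because
the given resolution of `U(a,a′)` is an isomorphism over it. Conclude with `towerStep`.
[folklore; CoxLittleSchenck2011 §10.2; Kollár 2007 §2.2] -/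
theorem toric_step (r a d a' : ℕ) (ha : 1 ≤ a) (har : a < r) (hda : a' + r = d * a) (ha'a : a' < a)
    (x xy w : ↥TA[r, a]) (hx : (x : Lk) = AddMonoidAlgebra.single ((1 : ℤ), (0 : ℤ)) 1)
    (hxy : (xy : Lk) = AddMonoidAlgebra.single ((1 : ℤ), (1 : ℤ)) 1)
    (hw : (w : Lk) = AddMonoidAlgebra.single ((a : ℤ), (r : ℤ)) 1)
    (x' w' : ↥TA[a, a']) (hx' : (x' : Lk) = AddMonoidAlgebra.single ((1 : ℤ), (0 : ℤ)) 1)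
    (hw' : (w' : Lk) = AddMonoidAlgebra.single ((a' : ℤ), (a : ℤ)) 1)
    (ih : ∃ (Y : Scheme.{0}) (ρ : Y ⟶ Spec (CommRingCat.of ↥TA[a, a'])), IsProper ρ ∧ Scheme.IsRegular Y ∧
      IsIso (ρ ∣_ ((PrimeSpectrum.basicOpen x' ⊔ PrimeSpectrum.basicOpen w' :
        (Spec (CommRingCat.of ↥TA[a, a'])).Opens))) ∧
      Dense ((ρ ⁻¹ᵁ ((PrimeSpectrum.basicOpen x' ⊔ PrimeSpectrum.basicOpen w' :
        (Spec (CommRingCat.of ↥TA[a, a'])).Opens)) : Y.Opens) : Set Y)) :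
    ∃ (Y : Scheme.{0}) (ρ : Y ⟶ Spec (CommRingCat.of ↥TA[r, a])), IsProper ρ ∧ Scheme.IsRegular Y ∧
      IsIso (ρ ∣_ ((PrimeSpectrum.basicOpen x ⊔ PrimeSpectrum.basicOpen w :
        (Spec (CommRingCat.of ↥TA[r, a])).Opens))) ∧
      Dense ((ρ ⁻¹ᵁ ((PrimeSpectrum.basicOpen x ⊔ PrimeSpectrum.basicOpen w :
        (Spec (CommRingCat.of ↥TA[r, a])).Opens)) : Y.Opens) : Set Y) := by
  obtain ⟨Y, ρ, hρ, hYreg, hρiso, hρd⟩ := ih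
  haveI := hρ
  have hr : 1 ≤ r := by omega
  -- the centre `I = (xy, x, x)` as the span of the opaque family `v = (x, x, xy)`
  obtain ⟨v, hv⟩ : ∃ v : Fin 3 → ↥TA[r, a], v = ![x, x, xy] := ⟨_, rfl⟩
  have hIv : Ideal.span (Set.range v) = Ideal.span {xy, x, x} := by
    rw [span_range_fin_three v, hv]; rfl
  have hv0 : v 0 = x := by rw [hv]; rfl
  have hv1 : v 1 = x := by rw [hv]; rfl
  have hv2 : v 2 = xy := by rw [hv]; rfl
  -- the regular charts `D₊(x t)`
  have hBx : IsRegularRing (blowupAlgebra (Ideal.span (Set.range v)) (v 0)) := by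
    rw [hIv, hv0]; exact stub_toric_xChart_isRegularRing k r a hr har.le x xy hx hxy
  have hBx1 : IsRegularRing (blowupAlgebra (Ideal.span (Set.range v)) (v 1)) := by
    rw [hIv, hv1]; exact stub_toric_xChart_isRegularRing k r a hr har.le x xy hx hxy
  haveI : IsDomain ↥TA[r, a] := inferInstance
  have hx0 : v 0 ≠ 0 := by rw [hv0]; exact toric_single_ne_zero k r a x _ hx
  -- `π₀` is an isomorphism over `D(x) ∪ D(w)`
  have hisoU : IsIso (affineBlowup.π (Ideal.span (Set.range v)) ∣_
      ((PrimeSpectrum.basicOpen x ⊔ PrimeSpectrum.basicOpen w : (Spec (CommRingCat.of ↥TA[r, a])).Opens))) := by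
    have h2 : IsIso (affineBlowup.π (Ideal.span (Set.range v)) ∣_
        (PrimeSpectrum.basicOpen w : (Spec (CommRingCat.of ↥TA[r, a])).Opens)) := by
      rw [hIv]; exact stub_toric_isIso_away_w k r a ha har.le x xy w hx hxy hw
    have h1 : IsIso (affineBlowup.π (Ideal.span (Set.range v)) ∣_
        (PrimeSpectrum.basicOpen x : (Spec (CommRingCat.of ↥TA[r, a])).Opens)) := by
      rw [← hv0]
      exact affineBlowup.isIso_morphismRestrict (I := Ideal.span (Set.range v)) _
        (Ideal.mem_span_range_self (x := 0))
    exact isIso_morphismRestrict_sup _ h1 h2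
  -- the recursive chart: `f = e⁻¹ ∘ Θ : TA[a,a'] → TA[r,a][1/b]`, `b = v 2 = xy`
  haveI : IsLocalization.Away (v 2) Lk := by
    rw [hv2]; exact stub_toric_isLocalization_away k r a har xy hxy
  let e : Localization.Away (v 2) ≃ₐ[↥TA[r, a]] Lk :=
    IsLocalization.algEquiv (Submonoid.powers (v 2)) (Localization.Away (v 2)) Lk
  obtain ⟨Θ, hΘ, hΘmap⟩ := stub_toric_theta k r a d a' ha hda ha'a
  have hcar : (Subalgebra.map e.toAlgHom (blowupAlgebra (Ideal.span (Set.range v)) (v 2))).restrictScalars k =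
      Algebra.adjoin k ((fun m : ℤ × ℤ => AddMonoidAlgebra.single m (1 : k)) ''
        {m : ℤ × ℤ | 0 ≤ m.1 ∧ ((a : ℕ) : ℤ) * m.2 ≤ ((r : ℕ) : ℤ) * m.1}) := by
    have h := stub_toric_yChart_carrier k r a har x xy hx hxy
    rw [← hIv, ← hv2] at h
    exact h e
  let f : ↥TA[a, a'] →+* Localization.Away (v 2) :=
    (e.symm : Lk →+* Localization.Away (v 2)).comp ((Θ : Lk →+* Lk).comp (TA[a, a']).val.toRingHom)
  have hfapply : ∀ t : ↥TA[a, a'], f t = e.symm (Θ (t : Lk)) := fun t => rfl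
  have hfinj : Function.Injective f := by
    intro t₁ t₂ h12
    rw [hfapply, hfapply] at h12
    exact Subtype.val_injective (Θ.injective (e.symm.injective h12))
  have hfrange : Set.range f = (blowupAlgebra (Ideal.span (Set.range v)) (v 2) :
      Set (Localization.Away (v 2))) := by
    -- `Θ '' TA[a,a'] = e '' TA[r,a][I/b]` as subsets of `Lk`
    have h1 : (Θ : Lk → Lk) '' (TA[a, a'] : Set Lk) =
        (Algebra.adjoin k ((fun m : ℤ × ℤ => AddMonoidAlgebra.single m (1 : k)) ''
          {m : ℤ × ℤ | 0 ≤ m.1 ∧ ((a : ℕ) : ℤ) * m.2 ≤ ((r : ℕ) : ℤ) * m.1}) : Set Lk) := by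
      rw [← hΘmap, Subalgebra.coe_map]; rfl
    have h2 : (e : Localization.Away (v 2) → Lk) '' (blowupAlgebra (Ideal.span (Set.range v)) (v 2) :
        Set (Localization.Away (v 2))) =
        (Algebra.adjoin k ((fun m : ℤ × ℤ => AddMonoidAlgebra.single m (1 : k)) ''
          {m : ℤ × ℤ | 0 ≤ m.1 ∧ ((a : ℕ) : ℤ) * m.2 ≤ ((r : ℕ) : ℤ) * m.1}) : Set Lk) := by
      rw [← hcar, Subalgebra.coe_restrictScalars, Subalgebra.coe_map]; rfl
    ext z
    constructor
    · rintro ⟨t, rfl⟩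
      rw [hfapply]
      have ht : Θ (t : Lk) ∈ (e : Localization.Away (v 2) → Lk) ''
          (blowupAlgebra (Ideal.span (Set.range v)) (v 2) : Set (Localization.Away (v 2))) := by
        rw [h2, ← h1]; exact ⟨t, t.2, rfl⟩
      obtain ⟨z', hz', hz'eq⟩ := ht
      rw [← hz'eq, AlgEquiv.symm_apply_apply]
      exact hz'
    · intro hz
      have hz' : e z ∈ (Θ : Lk → Lk) '' (TA[a, a'] : Set Lk) := by
        rw [h1, ← h2]; exact ⟨z, hz, rfl⟩
      obtain ⟨t, ht, hteq⟩ := hz'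
      refine ⟨⟨t, ht⟩, ?_⟩
      rw [hfapply]
      change e.symm (Θ t) = z
      rw [hteq, AlgEquiv.symm_apply_apply]
  -- values of `f`: `e (z/1) = z` for `z ∈ TA[r,a]`; `f x' · b = x`, `f w' = w`
  have healg : ∀ z : ↥TA[r, a], e (algebraMap (↥TA[r, a]) (Localization.Away (v 2)) z) = (z : Lk) := by
    intro z
    rw [AlgEquiv.commutes, Subalgebra.algebraMap_apply]
  have hfx' : f x' * algebraMap (↥TA[r, a]) (Localization.Away (v 2)) (v 2) =
      algebraMap (↥TA[r, a]) (Localization.Away (v 2)) (v 0) := by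
    apply e.injective
    rw [map_mul, hfapply, AlgEquiv.apply_symm_apply, healg, healg, hv2, hv0, hx', hΘ, hxy, hx,
      AddMonoidAlgebra.single_mul_single]
    norm_num
  have hfw' : f w' = algebraMap (↥TA[r, a]) (Localization.Away (v 2)) w := by
    apply e.injective
    rw [hfapply, AlgEquiv.apply_symm_apply, healg, hw', hΘ, hw]
    congr 1
    refine Prod.ext rfl ?_
    simp only
    have hda' : (a' : ℤ) + r = d * a := by exact_mod_cast hda
    linear_combination -hda'
  -- the open immersion `iV : U(a,a') → B` onto the chart `D₊(b t)`
  obtain ⟨iV, hiVoi, hrange, hpreChart, hpreBase⟩ := chart_openImmersion_of_range (↥TA[r, a])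
    (Ideal.span (Set.range v)) (v 2) (Ideal.mem_span_range_self (x := 2)) (↥TA[a, a']) f hfinj hfrange
  haveI := hiVoi
  have hVx0 : iV ⁻¹ᵁ Proj.basicOpen (reesGrading (Ideal.span (Set.range v)))
      (reesT (v 0) (Ideal.mem_span_range_self (f := v) (x := 0))) = PrimeSpectrum.basicOpen x' :=
    hpreChart (v 0) _ x' hfx'
  have hVx1 : iV ⁻¹ᵁ Proj.basicOpen (reesGrading (Ideal.span (Set.range v)))
      (reesT (v 1) (Ideal.mem_span_range_self (f := v) (x := 1))) = PrimeSpectrum.basicOpen x' := by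
    have h10 : v 1 = v 0 := by rw [hv1, hv0]
    have hfx1 : f x' * algebraMap (↥TA[r, a]) (Localization.Away (v 2)) (v 2) =
        algebraMap (↥TA[r, a]) (Localization.Away (v 2)) (v 1) := by rw [h10]; exact hfx'
    exact hpreChart (v 1) _ x' hfx1
  have hVw : (iV ≫ affineBlowup.π (Ideal.span (Set.range v))) ⁻¹ᵁ
      (PrimeSpectrum.basicOpen w : (Spec (CommRingCat.of ↥TA[r, a])).Opens) = PrimeSpectrum.basicOpen w' :=
    hpreBase w w' hfw'
  have hrange' : ∀ p : affineBlowup (Ideal.span (Set.range v)), p ∈ Set.range iV ↔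
      p ∈ Proj.basicOpen (reesGrading (Ideal.span (Set.range v)))
        (reesT (v 2) (Ideal.mem_span_range_self (f := v) (x := 2))) := fun p => by
    rw [hrange]; rfl
  -- the regular open `U_V = D(x') ∪ D(w')` of the recursive chart (regular by the induction hypothesis)
  have hUV : Scheme.IsRegular ((PrimeSpectrum.basicOpen x' ⊔ PrimeSpectrum.basicOpen w' :
      (Spec (CommRingCat.of ↥TA[a, a'])).Opens) : Scheme.{0}) :=
    isRegular_opens_of_isIso_morphismRestrict ρ _ hρiso hYreg
  -- `towerStep`
  haveI : IsProper (affineBlowup.π (Ideal.span (Set.range v))) :=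
    affineBlowup.isProper_of_fg (I := Ideal.span (Set.range v)) (Submodule.fg_span (Set.finite_range v))
  refine towerStep (affineBlowup.π (Ideal.span (Set.range v))) _ hisoU (PrimeSpectrum.basicOpen (v 0))
    (fun p hp => Or.inl (by rw [hv0] at hp; exact hp))
    (affineBlowup.dense_preimage_basicOpen (I := Ideal.span (Set.range v)) (v 0)
      (Ideal.mem_span_range_self (x := 0)) hx0)
    _ _ (fun p hp => affineBlowup_chart_regular_piece _ (v 0) _ hBx p hp)
    (fun p hp => affineBlowup_chart_regular_piece _ (v 1) _ hBx1 p hp)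
    iV (PrimeSpectrum.basicOpen x' ⊔ PrimeSpectrum.basicOpen w' :
      (Spec (CommRingCat.of ↥TA[a, a'])).Opens) hUV
    (by rw [hVx0]; exact fun q hq => Or.inl hq)
    (by rw [hVx1]; exact fun q hq => Or.inl hq)
    (fun p => tower_cover v iV hrange' p) ?_ ρ hYreg hρiso hρd
  -- `π₀⁻¹ (D(x) ∪ D(w)) ⊆ D₊(x t) ∪ D₊(x t) ∪ iV(D(x') ∪ D(w'))`
  intro p hp
  rcases hp with h | h
  · have h' : p ∈ affineBlowup.π (Ideal.span (Set.range v)) ⁻¹ᵁ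
        (PrimeSpectrum.basicOpen (v 0) : (Spec (CommRingCat.of ↥TA[r, a])).Opens) := by
      rw [hv0]; exact h
    exact Or.inl (Or.inl (affineBlowup.preimage_basicOpen_le (I := Ideal.span (Set.range v))
      (v 0) (Ideal.mem_span_range_self (x := 0)) h'))
  · rcases tower_cover v iV hrange' p with h1 | h1 | h1
    · exact Or.inl (Or.inl h1)
    · exact Or.inl (Or.inr h1)
    · obtain ⟨q, rfl⟩ := h1
      have hq : q ∈ (iV ≫ affineBlowup.π (Ideal.span (Set.range v))) ⁻¹ᵁ
          (PrimeSpectrum.basicOpen w : (Spec (CommRingCat.of ↥TA[r, a])).Opens) := by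
        show (iV ≫ affineBlowup.π (Ideal.span (Set.range v))) q ∈ PrimeSpectrum.basicOpen w
        rw [Scheme.Hom.comp_apply]
        exact h
      rw [hVw] at hq
      exact Or.inr ⟨q, Or.inr hq, rfl⟩

/-- **`P(r, 0)`**: `TA[r,0] = k[ℕ²]` is a regular ring (`stub_toric_base_isRegularRing`), so the identity is
the required morphism (`D(x)` is dense since `x ≠ 0` in the domain `TA[r,0]`). [folklore] -/
theorem toric_base (r : ℕ) (hr : 1 ≤ r) (x w : ↥TA[r, 0])
    (hx : (x : Lk) = AddMonoidAlgebra.single ((1 : ℤ), (0 : ℤ)) 1) :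
    ∃ (Y : Scheme.{0}) (ρ : Y ⟶ Spec (CommRingCat.of ↥TA[r, 0])), IsProper ρ ∧ Scheme.IsRegular Y ∧
      IsIso (ρ ∣_ ((PrimeSpectrum.basicOpen x ⊔ PrimeSpectrum.basicOpen w :
        (Spec (CommRingCat.of ↥TA[r, 0])).Opens))) ∧
      Dense ((ρ ⁻¹ᵁ ((PrimeSpectrum.basicOpen x ⊔ PrimeSpectrum.basicOpen w :
        (Spec (CommRingCat.of ↥TA[r, 0])).Opens)) : Y.Opens) : Set Y) := by
  haveI : IsRegularRing (CommRingCat.of ↥TA[r, 0]) := stub_toric_base_isRegularRing k r hr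
  haveI : IsDomain ↥TA[r, 0] := inferInstance
  refine ⟨_, 𝟙 _, inferInstance, Scheme.isRegular_Spec _, inferInstance, ?_⟩
  refine Dense.mono (fun p hp => Or.inl hp) ?_
  exact dense_basicOpen_of_ne_zero (R := ↥TA[r, 0]) _ (toric_single_ne_zero k r 0 x _ hx)

/-- The Hirzebruch–Jung recursion data: for `1 ≤ a` let `d = ⌈r/a⌉ = (r + a − 1)/a` and `a′ = d a − r`; then
`a′ + r = d a` and, if `a < r`… in fact always, `a′ < a`. [folklore] -/
theorem toric_hj_data (r a : ℕ) (ha : 1 ≤ a) :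
    ((r + a - 1) / a * a - r) + r = (r + a - 1) / a * a ∧ (r + a - 1) / a * a - r < a := by
  have h1 : (r + a - 1) / a * a ≤ r + a - 1 := Nat.div_mul_le_self _ _
  have h2 : r + a - 1 < (r + a - 1) / a * a + a := Nat.lt_div_mul_add (by omega)
  omega

/-- **`P(r, a)` FOR ALL `a < r`, EVERY FIELD** (registered stub of the skeleton, proved): `U(r,a)` receives
a proper morphism from a regular scheme which is an isomorphism over `D(x) ∪ D(w)` — the complement of the
torus-fixed point — with dense preimage. Strong induction on `r`: `P(r,0)` is `toric_base`; for `1 ≤ a < r`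
the step `toric_step` reduces to `P(a, ⌈r/a⌉a − r)` with `⌈r/a⌉a − r < a < r`.
[folklore; CoxLittleSchenck2011 Thm. 10.1.10, §10.2] -/
theorem stub_toric_offVertex_resolution (r a : ℕ) (har : a < r) (x w : ↥TA[r, a])
    (hx : (x : Lk) = AddMonoidAlgebra.single ((1 : ℤ), (0 : ℤ)) 1)
    (hw : (w : Lk) = AddMonoidAlgebra.single ((a : ℤ), (r : ℤ)) 1) :
    ∃ (Y : Scheme.{0}) (ρ : Y ⟶ Spec (CommRingCat.of ↥TA[r, a])), IsProper ρ ∧ Scheme.IsRegular Y ∧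
      IsIso (ρ ∣_ ((PrimeSpectrum.basicOpen x ⊔ PrimeSpectrum.basicOpen w :
        (Spec (CommRingCat.of ↥TA[r, a])).Opens))) ∧
      Dense ((ρ ⁻¹ᵁ ((PrimeSpectrum.basicOpen x ⊔ PrimeSpectrum.basicOpen w :
        (Spec (CommRingCat.of ↥TA[r, a])).Opens)) : Y.Opens) : Set Y) := by
  induction r using Nat.strong_induction_on generalizing a with
  | _ r ih =>
    rcases Nat.eq_zero_or_pos a with rfl | ha
    · exact toric_base k r (by omega) x w hx
    · obtain ⟨hda, ha'a⟩ := toric_hj_data r a ha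
      -- the distinguished monomials of `TA[a, a']`
      have hx'mem : (AddMonoidAlgebra.single ((1 : ℤ), (0 : ℤ)) (1 : k) : Lk) ∈
          TA[a, (r + a - 1) / a * a - r] :=
        Algebra.subset_adjoin ⟨((1 : ℤ), (0 : ℤ)), ⟨le_refl _, by simp⟩, rfl⟩
      have hw'mem : (AddMonoidAlgebra.single ((((r + a - 1) / a * a - r : ℕ) : ℤ), (a : ℤ)) (1 : k) : Lk) ∈
          TA[a, (r + a - 1) / a * a - r] :=
        Algebra.subset_adjoin ⟨_, ⟨by positivity, by rw [mul_comm]⟩, rfl⟩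
      have hxymem : (AddMonoidAlgebra.single ((1 : ℤ), (1 : ℤ)) (1 : k) : Lk) ∈ TA[r, a] :=
        Algebra.subset_adjoin ⟨((1 : ℤ), (1 : ℤ)), ⟨zero_le_one, by norm_num; exact_mod_cast har.le⟩, rfl⟩
      exact toric_step k r a ((r + a - 1) / a) ((r + a - 1) / a * a - r) ha har hda ha'a x ⟨_, hxymem⟩ w
        hx rfl hw ⟨_, hx'mem⟩ ⟨_, hw'mem⟩ rfl rfl (ih a har _ ha'a ⟨_, hx'mem⟩ ⟨_, hw'mem⟩ rfl rfl)

/-- **RUNG 4′ ON ALL AFFINE TORIC SURFACES, EVERY FIELD.** For every field `k` and all `a < r`, the affine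
toric surface `U(r,a) = Spec k[{m ∈ ℤ² : 0 ≤ m₂, a m₂ ≤ r m₁}]` — every cyclic quotient surface singularity
`1/r(1,a)`, i.e. every two-dimensional diagonalizable quotient `k[x,y]^{μ_r}` including the wild case `p ∣ r`
(the 2-dimensional, Zariski-chart, all-fields instance of the redirect line's endgame
`stub_diagonalizableQuotientResolution`) — HAS A RESOLUTION OF SINGULARITIES which is an isomorphism off the
torus-fixed point, by the Hirzebruch–Jung tower of two-chart monomial blow-ups.
[folklore; CoxLittleSchenck2011 Thm. 10.1.10] -/
theorem hasResolution_toricSurface (r a : ℕ) (har : a < r) :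
    Scheme.HasResolution (Spec (CommRingCat.of ↥TA[r, a])) := by
  have hxmem : (AddMonoidAlgebra.single ((1 : ℤ), (0 : ℤ)) (1 : k) : Lk) ∈ TA[r, a] :=
    Algebra.subset_adjoin ⟨((1 : ℤ), (0 : ℤ)), ⟨le_refl _, by simp⟩, rfl⟩
  have hwmem : (AddMonoidAlgebra.single ((a : ℤ), (r : ℤ)) (1 : k) : Lk) ∈ TA[r, a] :=
    Algebra.subset_adjoin ⟨((a : ℤ), (r : ℤ)), ⟨by positivity, by rw [mul_comm]⟩, rfl⟩
  obtain ⟨Y, ρ, hρ, hreg, hiso, hd⟩ :=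
    stub_toric_offVertex_resolution k r a har ⟨_, hxmem⟩ ⟨_, hwmem⟩ rfl rfl
  haveI : IsDomain ↥TA[r, a] := inferInstance
  have hx0 : (⟨_, hxmem⟩ : ↥TA[r, a]) ≠ 0 := toric_single_ne_zero k r a _ _ rfl
  have hdense : Dense (((PrimeSpectrum.basicOpen (⟨_, hxmem⟩ : ↥TA[r, a]) ⊔
      PrimeSpectrum.basicOpen (⟨_, hwmem⟩ : ↥TA[r, a]) :
        (Spec (CommRingCat.of ↥TA[r, a])).Opens)) : Set (Spec (CommRingCat.of ↥TA[r, a]))) := by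
    refine Dense.mono (fun p hp => Or.inl hp) ?_
    exact dense_basicOpen_of_ne_zero (R := ↥TA[r, a]) _ hx0
  exact ⟨Y, ρ, ⟨hρ, ⟨_, hdense, hd, hiso⟩, hreg⟩⟩

end Toric

end Summit.ResolutionOfSingularities.ResolutionOfSingularities.Theorems.FRationalResolution

end
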